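import Literature.NumberTheory.Multiplicative.SmoothNumbersRankinTail
import HarnessLib

/-!
# Route `ChenParityOracleBLAP` — crux S1 = `HostParityFromBrick` (stmt-Parity-20045): collecting the pairs `(b, e) ↦ r = be`

Support file for the prime half `K1 → K2 → HP1` of S1, sifting step (S).  After the truncated
sifting identity the Type-I piece is a double sum over a rough outer variable `b` (coefficients
`|c_b| ≤ 1`, `c_b ≠ 0 ⇒ (b, P) = 1`) and a divisor `e ∣ P` of the primorial, acting through the
product `r = be`.  Since `e = (r, P)` is determined by `r`, the collected coefficients
`C_r = ∑_{be = r} c_b μ(e)` satisfy `|C_r| ≤ 1` (`sum_pairs_eq_sum_collected`).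

References: H. Iwaniec, E. Kowalski, *Analytic Number Theory* (2004), §13.4 [IwaniecKowalski2004].
-/

namespace Summit.Parity.GeneralizedHardyLittlewood.Theorems

open Finset Real
open ArithmeticFunction (moebius)

/-- **Collecting `(b,e) ↦ be`.**  Let `P ≠ 0`, `|c_b| ≤ 1` with `c_b ≠ 0 ⇒ (b,P) = 1`, `E` a set of
divisors of `P`, and `R` with `be ≤ R` for `b ∈ [1,B]`, `e ∈ E`.  Then there are collected
coefficients `C` with `|C_r| ≤ 1`, `C_r ≠ 0 ⇒ r = be` for some `b ∈ [1,B]` with `c_b ≠ 0` and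
`e ∈ E`, and `∑_{b ≤ B} c_b ∑_{e ∈ E} μ(e) G(be) = ∑_{r ≤ R} C_r G(r)` for every `G`. -/
theorem sum_pairs_eq_sum_collected {P B R : ℕ} (hP : P ≠ 0) (cb : ℕ → ℝ) (hcb1 : ∀ b, |cb b| ≤ 1)
    (hcbP : ∀ b, cb b ≠ 0 → Nat.Coprime b P) (E : Finset ℕ) (hE : ∀ e ∈ E, e ∣ P)
    (hR : ∀ b ∈ Icc 1 B, ∀ e ∈ E, b * e ≤ R) :
    ∃ C : ℕ → ℝ, (∀ r, |C r| ≤ 1) ∧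
      (∀ r, C r ≠ 0 → ∃ b ∈ Icc 1 B, ∃ e ∈ E, cb b ≠ 0 ∧ b * e = r) ∧
      ∀ G : ℕ → ℝ, ∑ b ∈ Icc 1 B, cb b * ∑ e ∈ E, (moebius e : ℝ) * G (b * e) =
        ∑ r ∈ Icc 1 R, C r * G r := by
  classical
  set f : ℕ → ℕ → ℕ → ℝ := fun r b e => if b * e = r then cb b * (moebius e : ℝ) else 0 with hf
  set C : ℕ → ℝ := fun r => ∑ b ∈ Icc 1 B, ∑ e ∈ E, f r b e with hC
  have hE0 : ∀ e ∈ E, 0 < e := fun e he => Nat.pos_of_dvd_of_pos (hE e he) (Nat.pos_of_ne_zero hP)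
  -- the only contributing pair for `r` is `(r / gcd r P, gcd r P)`
  have hpair : ∀ r b e, e ∈ E → f r b e ≠ 0 → b * e = r ∧ e = Nat.gcd r P ∧ b = r / Nat.gcd r P := by
    intro r b e he hne
    simp only [hf] at hne
    split_ifs at hne with hbe
    · have hcb : cb b ≠ 0 := fun h => hne (by rw [h, zero_mul])
      have hcop := hcbP b hcb
      have hge : Nat.gcd r P = e := by
        rw [← hbe, Nat.Coprime.gcd_mul_left_cancel e hcop]
        exact Nat.gcd_eq_left (hE e he)
      refine ⟨hbe, hge.symm, ?_⟩
      rw [hge, ← hbe, Nat.mul_div_cancel _ (hE0 e he)]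
    · exact absurd rfl hne
  refine ⟨C, fun r => ?_, fun r hr => ?_, fun G => ?_⟩
  · -- `|C r| ≤ 1`
    set e₀ := Nat.gcd r P
    set b₀ := r / Nat.gcd r P
    have hCeq : C r = ∑ b ∈ Icc 1 B, ∑ e ∈ E, (if b = b₀ ∧ e = e₀ then f r b e else 0) := by
      simp only [hC]
      refine Finset.sum_congr rfl fun b _ => Finset.sum_congr rfl fun e he => ?_
      by_cases h : f r b e = 0
      · rw [h]; split_ifs <;> rfl
      · obtain ⟨-, h2, h3⟩ := hpair r b e he h
        rw [if_pos ⟨h3, h2⟩]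
    rw [hCeq]
    have hinner : ∀ b ∈ Icc 1 B, ∑ e ∈ E, (if b = b₀ ∧ e = e₀ then f r b e else 0) =
        if b = b₀ then (if e₀ ∈ E then f r b e₀ else 0) else 0 := by
      intro b _
      by_cases hb : b = b₀
      · simp only [hb, true_and, if_true]
        rw [Finset.sum_ite_eq' E e₀ (fun e => f r b₀ e)]
      · simp only [hb, false_and, if_false, Finset.sum_const_zero]
    rw [Finset.sum_congr rfl hinner, Finset.sum_ite_eq' (Icc 1 B) b₀]
    have hf1 : ∀ b e, |f r b e| ≤ 1 := by
      intro b e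
      simp only [hf]
      split_ifs
      · rw [abs_mul]
        have hmu : |(moebius e : ℝ)| ≤ 1 := by exact_mod_cast ArithmeticFunction.abs_moebius_le_one
        exact (mul_le_mul (hcb1 b) hmu (abs_nonneg _) zero_le_one).trans (by norm_num)
      · simp
    split_ifs
    · exact hf1 _ _
    · simp
    · simp
  · -- support of `C`
    obtain ⟨b, hb, hne⟩ := Finset.exists_ne_zero_of_sum_ne_zero hr
    obtain ⟨e, he, hne'⟩ := Finset.exists_ne_zero_of_sum_ne_zero hne
    have h1 := hpair r b e he hne'
    refine ⟨b, hb, e, he, ?_, h1.1⟩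
    intro h; apply hne'; simp only [hf, h, zero_mul, ite_self]
  · -- the identity
    have hlhs : ∑ b ∈ Icc 1 B, cb b * ∑ e ∈ E, (moebius e : ℝ) * G (b * e) =
        ∑ b ∈ Icc 1 B, ∑ e ∈ E, ∑ r ∈ Icc 1 R, f r b e * G r := by
      refine Finset.sum_congr rfl fun b hb => ?_
      rw [Finset.mul_sum]
      refine Finset.sum_congr rfl fun e he => ?_
      have hmem : b * e ∈ Icc 1 R := by
        rw [Finset.mem_Icc] at hb ⊢
        exact ⟨Nat.le_mul_of_pos_right b (hE0 e he) |>.trans' hb.1, hR b (Finset.mem_Icc.mpr hb) e he⟩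
      simp only [hf, ite_mul, zero_mul]
      rw [Finset.sum_ite_eq (Icc 1 R) (b * e) (fun r => cb b * (moebius e : ℝ) * G r), if_pos hmem]
      ring
    rw [hlhs]
    have h2 : ∀ b ∈ Icc 1 B, ∑ e ∈ E, ∑ r ∈ Icc 1 R, f r b e * G r =
        ∑ r ∈ Icc 1 R, ∑ e ∈ E, f r b e * G r := fun b _ => Finset.sum_comm
    rw [Finset.sum_congr rfl h2, Finset.sum_comm]
    refine Finset.sum_congr rfl fun r _ => ?_
    simp only [hC]
    rw [Finset.sum_mul]
    exact Finset.sum_congr rfl fun b _ => by rw [Finset.sum_mul]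

end Summit.Parity.GeneralizedHardyLittlewood.Theorems
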